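import Mathlib
import HarnessLib
import Summits.ValiantsHypothesis.ValiantsHypothesis.Theorems.LacunarySymmetroidMatrixDescartesProductPlusOneRowTowerKCalculus8
import Summits.ValiantsHypothesis.ValiantsHypothesis.Theorems.LacunarySymmetroidMatrixDescartesProductPlusOneRowTowerKLine
import Summits.ValiantsHypothesis.ValiantsHypothesis.Theorems.LacunarySymmetroidMatrixDescartesProductPlusOneSixthOrderShell

/-!
# LINE (A) `product_plus_one` (crux `MatrixDescartes`, stmt-ValiantsHypothesis-18050, V1) — W-CB §30.1 (i)/(ii), THE ORDER-6 IMAGE CELL FOR EVERY K: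
# if the company's order-8 image `Σ_j (ψ₇ − e₁ψ₅ + e₂ψ₃ − e₃ψ₁)^{(j)}` does not vanish on a pole-free window, `W(∏_j f_j)` has AT MOST SIX roots there

The θ-shell of order six ✓ `no_seven_zeros_of_sixth_order_law` (E2a, val-lit-p7 g18) run on the every-K row tower ✓ `…RowTowerKDefs` / ✓ `…RowTowerKDefs8`
(val-lit-p5 g16/g17): support `d : Fin (n+2) → ℕ`, `StrictMono d`; rows `f_j = Σ_l C (a j l) X^{d l}` (ANY number of letters, any signs, zero letters allowed);
window `(u,v)`, `0 < u`, on which no stripped row `a j 0 − Σ_l (−a j l.succ) x^{d l.succ − d 0}` vanishes; three natural rates `k₁+1, k₂+1, k₃+1`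
(free; `eᵢ` their squared elementary symmetric functions).  With `S_i := Σ_j ψ_{i+1}^{(j)}` (`θS_i = S_{i+1}` by ✓ `hasDerivAt_rowPsiK1/2` + ✓ `hasDerivAt_rowPsiK3…6`)
and `W(∏f_j) = −(∏f_j)²·S₀` (✓ `logWronskian_prodK_eq_rowPsiK1_sum`):
* ★ `wronskianK_no_seven_zeros_of_image` — `Σ_j image^{(j)} ≠ 0` on the window ⇒ no strictly increasing 7-chain of roots of `W(∏f_j)` in `(u,v)`;
* ★★ `wronskianK_roots_le_six_of_image` — counting form: at most SIX roots in `(u,v)`;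
* ★★ `wronskianK_roots_le_six_of_rowImages` — TERMWISE form: every row's own image `> 0` on the window (and `0 < m`) ⇒ at most six roots.
The per-row image signs are supplied by ROW IMAGE LAWS: clouds on their isolated-sign sides by ✓⧗ `rowPsiK_image8_pos_of_cloud_bottom'` (`3λ₀ ≤ λ₁`) /
✓⧗ `rowPsiK_image8_pos_of_cloud_top'` (`2λ₀ ≤ λ₁`) (val-lit-p5 g17, the CLOUD TRANSFER LAW), binomial letters by their closure polynomial `Q_r(ψ₁)` (E1/E3a at
K = 3).  This is memo §30.1 (i) with `ζ_I = 0` for ARBITRARY K-nomial companies — the binomial K = 3 instance is ✓ E3b `sixthOrder_ringfree_wronskian_roots_le_six`.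

HONEST FRAMING: ONE W-cell (helper), abstract in the per-row images; proves nothing about `WronskianBudgetK3` / `OneChangeFloorK3` / the stubs / 18050 /
`MatrixDescartes` / Conjecture B; `VP ≠ VNP` is NOT proved.  No definitions, no named facts, no sorry; Mathlib + ✓ lane modules only.
-/

set_option linter.dupNamespace false

namespace Summit.ValiantsHypothesis.ValiantsHypothesis.Theorems.LacunarySymmetroidMatrixDescartes

namespace ProductPlusOne

open Finset Set Polynomial
open scoped BigOperators Topology Polynomial

/-! ### §1 The engine: a non-vanishing company image kills 7-chains of roots of `W` -/

/-- ★ **ORDER-6 IMAGE ENGINE, every K.**  Stripped rows non-vanishing on `(u,v)` (`0 < u`) and the company image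
`Σ_j (ψ₇ − e₁ψ₅ + e₂ψ₃ − e₃ψ₁)^{(j)} ≠ 0` there (`e₁ = Σλᵢ²`, `e₂ = Σλᵢ²λⱼ²`, `e₃ = λ₁²λ₂²λ₃²`, `λᵢ = kᵢ+1`) ⇒ `W(∏_j f_j)` has no strictly increasing
chain of seven zeros in `(u,v)`. [this file's theorem] -/
theorem wronskianK_no_seven_zeros_of_image {m n : ℕ} (d : Fin (n + 2) → ℕ) (hd : StrictMono d)
    (a : Fin m → Fin (n + 2) → ℝ) {u v : ℝ} (hu : 0 < u) (k₁ k₂ k₃ : ℕ)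
    (hF : ∀ j, ∀ x ∈ Ioo u v, a j 0 - ∑ l : Fin (n + 1), (-(a j l.succ)) * x ^ (d l.succ - d 0) ≠ 0)
    (himg : ∀ x ∈ Ioo u v,
      ∑ j, (rowPsiK7 (fun l : Fin (n + 1) => d l.succ - d 0) (a j 0) (fun l : Fin (n + 1) => -(a j l.succ)) x
        - (((k₁ : ℝ) + 1) ^ 2 + ((k₂ : ℝ) + 1) ^ 2 + ((k₃ : ℝ) + 1) ^ 2)
            * rowPsiK5 (fun l : Fin (n + 1) => d l.succ - d 0) (a j 0) (fun l : Fin (n + 1) => -(a j l.succ)) x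
        + (((k₁ : ℝ) + 1) ^ 2 * ((k₂ : ℝ) + 1) ^ 2 + ((k₁ : ℝ) + 1) ^ 2 * ((k₃ : ℝ) + 1) ^ 2
              + ((k₂ : ℝ) + 1) ^ 2 * ((k₃ : ℝ) + 1) ^ 2)
            * rowPsiK3 (fun l : Fin (n + 1) => d l.succ - d 0) (a j 0) (fun l : Fin (n + 1) => -(a j l.succ)) x
        - ((k₁ : ℝ) + 1) ^ 2 * ((k₂ : ℝ) + 1) ^ 2 * ((k₃ : ℝ) + 1) ^ 2
            * rowPsiK1 (fun l : Fin (n + 1) => d l.succ - d 0) (a j 0) (fun l : Fin (n + 1) => -(a j l.succ)) x) ≠ 0)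
    (x : Fin 7 → ℝ) (hx : StrictMono x) (hxI : ∀ i, x i ∈ Ioo u v)
    (hzero : ∀ i,
      ((∏ j, ∑ l, C (a j l) * X ^ (d l) : ℝ[X]) * (X * derivative (X * derivative (∏ j, ∑ l, C (a j l) * X ^ (d l) : ℝ[X])))
        - (X * derivative (∏ j, ∑ l, C (a j l) * X ^ (d l) : ℝ[X])) ^ 2).eval (x i) = 0) : False := by
  classical
  set lam : Fin (n + 1) → ℕ := fun l => d l.succ - d 0 with hlam
  have hd0 : ∀ l, d 0 ≤ d l := fun l => hd.monotone (Fin.zero_le l)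
  have hev : ∀ j x, (∑ l, C (a j l) * X ^ (d l) : ℝ[X]).eval x
      = x ^ (d 0) * (a j 0 - ∑ l : Fin (n + 1), (-(a j l.succ)) * x ^ (d l.succ - d 0)) := fun j x => eval_rowK_eq d hd0 (a j) x
  have hf : ∀ x ∈ Ioo u v, ∀ j, (∑ l, C (a j l) * X ^ (d l) : ℝ[X]).eval x ≠ 0 := by
    intro x hx j
    rw [hev]
    exact mul_ne_zero (pow_ne_zero _ (hu.trans hx.1).ne') (hF j x hx)
  -- the hypotheses of the every-K calculus lemmas, in their `A − Σ_l B_l x^{λ_l}` spelling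
  have hF' : ∀ j, ∀ x ∈ Ioo u v, a j 0 - ∑ l, (fun l : Fin (n + 1) => -(a j l.succ)) l * x ^ (lam l) ≠ 0 := fun j x hx => hF j x hx
  have hsum : ∀ i, ∑ j, rowPsiK1 lam (a j 0) (fun l : Fin (n + 1) => -(a j l.succ)) (x i) = 0 := by
    intro i
    have hxI' := hxI i
    have hx0 : 0 < x i := hu.trans hxI'.1
    have h := hzero i
    rw [logWronskian_prodK_eq_rowPsiK1_sum d hd0 a hx0 (hf (x i) hxI')] at h
    have hP : ((∏ j, (∑ l, C (a j l) * X ^ (d l) : ℝ[X])).eval (x i)) ≠ 0 := by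
      rw [eval_prod]; exact Finset.prod_ne_zero_iff.2 fun j _ => hf (x i) hxI' j
    rcases mul_eq_zero.1 h with h1 | h1
    · exact absurd (neg_eq_zero.1 h1) (pow_ne_zero 2 hP)
    · exact h1
  -- derivative of a row-sum: `θ(Σ_j F_j) = Σ_j θF_j`
  have dsum : ∀ {F G : Fin m → ℝ → ℝ}, (∀ j, ∀ x ∈ Ioo u v, HasDerivAt (F j) (G j x / x) x) →
      ∀ x ∈ Ioo u v, HasDerivAt (fun t => ∑ j, F j t) ((∑ j, G j x) / x) x := by
    intro F G h x hx
    have h' := HasDerivAt.fun_sum (u := Finset.univ) (fun j _ => h j x hx)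
    simpa only [Finset.sum_div] using h'
  have hx0 : ∀ x ∈ Ioo u v, (x : ℝ) ≠ 0 := fun x hx => (hu.trans hx.1).ne'
  refine no_seven_zeros_of_sixth_order_law k₁ k₂ k₃ hu.le
    (S₀ := fun x => ∑ j, rowPsiK1 lam (a j 0) (fun l : Fin (n + 1) => -(a j l.succ)) x)
    (S₁ := fun x => ∑ j, rowPsiK2 lam (a j 0) (fun l : Fin (n + 1) => -(a j l.succ)) x)
    (S₂ := fun x => ∑ j, rowPsiK3 lam (a j 0) (fun l : Fin (n + 1) => -(a j l.succ)) x)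
    (S₃ := fun x => ∑ j, rowPsiK4 lam (a j 0) (fun l : Fin (n + 1) => -(a j l.succ)) x)
    (S₄ := fun x => ∑ j, rowPsiK5 lam (a j 0) (fun l : Fin (n + 1) => -(a j l.succ)) x)
    (S₅ := fun x => ∑ j, rowPsiK6 lam (a j 0) (fun l : Fin (n + 1) => -(a j l.succ)) x)
    (S₆ := fun x => ∑ j, rowPsiK7 lam (a j 0) (fun l : Fin (n + 1) => -(a j l.succ)) x)
    (dsum fun j x hx => hasDerivAt_rowPsiK1 lam (a j 0) _ (hx0 x hx) (hF' j x hx))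
    (dsum fun j x hx => hasDerivAt_rowPsiK2 lam (a j 0) _ (hx0 x hx) (hF' j x hx))
    (dsum fun j x hx => hasDerivAt_rowPsiK3 lam (a j 0) _ (hx0 x hx) (hF' j x hx))
    (dsum fun j x hx => hasDerivAt_rowPsiK4 lam (a j 0) _ (hx0 x hx) (hF' j x hx))
    (dsum fun j x hx => hasDerivAt_rowPsiK5 lam (a j 0) _ (hx0 x hx) (hF' j x hx))
    (dsum fun j x hx => hasDerivAt_rowPsiK6 lam (a j 0) _ (hx0 x hx) (hF' j x hx))
    ?_ x hx hxI hsum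
  intro x hx
  have h := himg x hx
  -- the level-6 value of the summed tower is the sum of the row images
  have hre : (∑ j, rowPsiK7 lam (a j 0) (fun l : Fin (n + 1) => -(a j l.succ)) x)
      - (((k₁ : ℝ) + 1) ^ 2 + ((k₂ : ℝ) + 1) ^ 2 + ((k₃ : ℝ) + 1) ^ 2)
          * (∑ j, rowPsiK5 lam (a j 0) (fun l : Fin (n + 1) => -(a j l.succ)) x)
      + (((k₁ : ℝ) + 1) ^ 2 * ((k₂ : ℝ) + 1) ^ 2 + ((k₁ : ℝ) + 1) ^ 2 * ((k₃ : ℝ) + 1) ^ 2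
            + ((k₂ : ℝ) + 1) ^ 2 * ((k₃ : ℝ) + 1) ^ 2)
          * (∑ j, rowPsiK3 lam (a j 0) (fun l : Fin (n + 1) => -(a j l.succ)) x)
      - ((k₁ : ℝ) + 1) ^ 2 * ((k₂ : ℝ) + 1) ^ 2 * ((k₃ : ℝ) + 1) ^ 2
          * (∑ j, rowPsiK1 lam (a j 0) (fun l : Fin (n + 1) => -(a j l.succ)) x)
      = ∑ j, (rowPsiK7 lam (a j 0) (fun l : Fin (n + 1) => -(a j l.succ)) x
        - (((k₁ : ℝ) + 1) ^ 2 + ((k₂ : ℝ) + 1) ^ 2 + ((k₃ : ℝ) + 1) ^ 2)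
            * rowPsiK5 lam (a j 0) (fun l : Fin (n + 1) => -(a j l.succ)) x
        + (((k₁ : ℝ) + 1) ^ 2 * ((k₂ : ℝ) + 1) ^ 2 + ((k₁ : ℝ) + 1) ^ 2 * ((k₃ : ℝ) + 1) ^ 2
              + ((k₂ : ℝ) + 1) ^ 2 * ((k₃ : ℝ) + 1) ^ 2)
            * rowPsiK3 lam (a j 0) (fun l : Fin (n + 1) => -(a j l.succ)) x
        - ((k₁ : ℝ) + 1) ^ 2 * ((k₂ : ℝ) + 1) ^ 2 * ((k₃ : ℝ) + 1) ^ 2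
            * rowPsiK1 lam (a j 0) (fun l : Fin (n + 1) => -(a j l.succ)) x) := by
    simp only [Finset.sum_sub_distrib, Finset.sum_add_distrib, Finset.mul_sum]
  rw [hre]
  exact h

/-! ### §2 Counting forms -/

/-- ★★ **ORDER-6 IMAGE CELL, every K, counting form**: stripped rows non-vanishing and company image `≠ 0` on `(u,v)` ⇒ `W(∏_j f_j)` has AT MOST SIX
roots in `(u,v)`. [this file's theorem] -/
theorem wronskianK_roots_le_six_of_image {m n : ℕ} (d : Fin (n + 2) → ℕ) (hd : StrictMono d)
    (a : Fin m → Fin (n + 2) → ℝ) {u v : ℝ} (hu : 0 < u) (k₁ k₂ k₃ : ℕ)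
    (hF : ∀ j, ∀ x ∈ Ioo u v, a j 0 - ∑ l : Fin (n + 1), (-(a j l.succ)) * x ^ (d l.succ - d 0) ≠ 0)
    (himg : ∀ x ∈ Ioo u v,
      ∑ j, (rowPsiK7 (fun l : Fin (n + 1) => d l.succ - d 0) (a j 0) (fun l : Fin (n + 1) => -(a j l.succ)) x
        - (((k₁ : ℝ) + 1) ^ 2 + ((k₂ : ℝ) + 1) ^ 2 + ((k₃ : ℝ) + 1) ^ 2)
            * rowPsiK5 (fun l : Fin (n + 1) => d l.succ - d 0) (a j 0) (fun l : Fin (n + 1) => -(a j l.succ)) x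
        + (((k₁ : ℝ) + 1) ^ 2 * ((k₂ : ℝ) + 1) ^ 2 + ((k₁ : ℝ) + 1) ^ 2 * ((k₃ : ℝ) + 1) ^ 2
              + ((k₂ : ℝ) + 1) ^ 2 * ((k₃ : ℝ) + 1) ^ 2)
            * rowPsiK3 (fun l : Fin (n + 1) => d l.succ - d 0) (a j 0) (fun l : Fin (n + 1) => -(a j l.succ)) x
        - ((k₁ : ℝ) + 1) ^ 2 * ((k₂ : ℝ) + 1) ^ 2 * ((k₃ : ℝ) + 1) ^ 2
            * rowPsiK1 (fun l : Fin (n + 1) => d l.succ - d 0) (a j 0) (fun l : Fin (n + 1) => -(a j l.succ)) x) ≠ 0) :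
    (((∏ j, ∑ l, C (a j l) * X ^ (d l) : ℝ[X]) * (X * derivative (X * derivative (∏ j, ∑ l, C (a j l) * X ^ (d l) : ℝ[X])))
        - (X * derivative (∏ j, ∑ l, C (a j l) * X ^ (d l) : ℝ[X])) ^ 2).roots.toFinset.filter (fun t => u < t ∧ t < v)).card ≤ 6 := by
  classical
  set W : ℝ[X] := (∏ j, ∑ l, C (a j l) * X ^ (d l) : ℝ[X]) * (X * derivative (X * derivative (∏ j, ∑ l, C (a j l) * X ^ (d l) : ℝ[X])))
      - (X * derivative (∏ j, ∑ l, C (a j l) * X ^ (d l) : ℝ[X])) ^ 2 with hWdef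
  set T := W.roots.toFinset.filter (fun t => u < t ∧ t < v) with hT
  by_contra hgt
  push Not at hgt
  by_cases hW0 : W = 0
  · have : T = ∅ := by rw [hT, hW0, roots_zero, Multiset.toFinset_zero, Finset.filter_empty]
    rw [this, Finset.card_empty] at hgt; exact absurd hgt (by norm_num)
  obtain ⟨T', hT'T, hcard⟩ := Finset.exists_subset_card_eq (show 7 ≤ T.card by omega)
  set x : Fin 7 → ℝ := fun i => T'.orderEmbOfFin hcard i with hxdef
  have hxmono : StrictMono x := fun i j hij => (T'.orderEmbOfFin hcard).strictMono hij
  have hxmem : ∀ i, x i ∈ T := fun i => hT'T (T'.orderEmbOfFin_mem hcard i)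
  have hxI : ∀ i, x i ∈ Ioo u v := fun i => (Finset.mem_filter.1 (hxmem i)).2
  have hxz : ∀ i, W.eval (x i) = 0 := by
    intro i
    have h := (Finset.mem_filter.1 (hxmem i)).1
    rw [Multiset.mem_toFinset, mem_roots hW0] at h
    exact h
  exact wronskianK_no_seven_zeros_of_image d hd a hu k₁ k₂ k₃ hF himg x hxmono hxI hxz

/-- ★★ **ORDER-6 IMAGE CELL, every K, termwise form**: `0 < m`, stripped rows non-vanishing on `(u,v)`, and EVERY ROW'S OWN image
`ψ₇ − e₁ψ₅ + e₂ψ₃ − e₃ψ₁ > 0` on `(u,v)` ⇒ `W(∏_j f_j)` has at most six roots in `(u,v)`.  (Rows are fed by the row image laws: clouds on their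
isolated-sign sides by the cloud transfer laws, letters by their closure polynomials.) [this file's theorem] -/
theorem wronskianK_roots_le_six_of_rowImages {m n : ℕ} (hm : 0 < m) (d : Fin (n + 2) → ℕ) (hd : StrictMono d)
    (a : Fin m → Fin (n + 2) → ℝ) {u v : ℝ} (hu : 0 < u) (k₁ k₂ k₃ : ℕ)
    (hrow : ∀ j, ∀ x ∈ Ioo u v, a j 0 - ∑ l : Fin (n + 1), (-(a j l.succ)) * x ^ (d l.succ - d 0) ≠ 0 ∧
      0 < rowPsiK7 (fun l : Fin (n + 1) => d l.succ - d 0) (a j 0) (fun l : Fin (n + 1) => -(a j l.succ)) x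
        - (((k₁ : ℝ) + 1) ^ 2 + ((k₂ : ℝ) + 1) ^ 2 + ((k₃ : ℝ) + 1) ^ 2)
            * rowPsiK5 (fun l : Fin (n + 1) => d l.succ - d 0) (a j 0) (fun l : Fin (n + 1) => -(a j l.succ)) x
        + (((k₁ : ℝ) + 1) ^ 2 * ((k₂ : ℝ) + 1) ^ 2 + ((k₁ : ℝ) + 1) ^ 2 * ((k₃ : ℝ) + 1) ^ 2
              + ((k₂ : ℝ) + 1) ^ 2 * ((k₃ : ℝ) + 1) ^ 2)
            * rowPsiK3 (fun l : Fin (n + 1) => d l.succ - d 0) (a j 0) (fun l : Fin (n + 1) => -(a j l.succ)) x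
        - ((k₁ : ℝ) + 1) ^ 2 * ((k₂ : ℝ) + 1) ^ 2 * ((k₃ : ℝ) + 1) ^ 2
            * rowPsiK1 (fun l : Fin (n + 1) => d l.succ - d 0) (a j 0) (fun l : Fin (n + 1) => -(a j l.succ)) x) :
    (((∏ j, ∑ l, C (a j l) * X ^ (d l) : ℝ[X]) * (X * derivative (X * derivative (∏ j, ∑ l, C (a j l) * X ^ (d l) : ℝ[X])))
        - (X * derivative (∏ j, ∑ l, C (a j l) * X ^ (d l) : ℝ[X])) ^ 2).roots.toFinset.filter (fun t => u < t ∧ t < v)).card ≤ 6 := by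
  refine wronskianK_roots_le_six_of_image d hd a hu k₁ k₂ k₃ (fun j x hx => (hrow j x hx).1) ?_
  intro x hx
  exact (Finset.sum_pos (fun j _ => (hrow j x hx).2) ⟨⟨0, hm⟩, Finset.mem_univ _⟩).ne'

end ProductPlusOne

end Summit.ValiantsHypothesis.ValiantsHypothesis.Theorems.LacunarySymmetroidMatrixDescartes
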